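import Literature.NumberTheory.EllipticCurves.ModularSymbolsProofs
import Literature.NumberTheory.EllipticCurves.ModularSymbolsNormalizedSymbolProofs
import Literature.NumberTheory.EllipticCurves.PAdicLFunctionDistributionProofs
import Literature.NumberTheory.EllipticCurves.ModularFormsGamma0Genus
import Literature.NumberTheory.EllipticCurves.PAdicLFunctionMinus
import Literature.NumberTheory.Automorphic.ShimuraCurveRibetTakahashiPeterssonTwoPowerLevelProofs
import HarnessLib

/-!
# The minus modular symbol at `γ·0` IS a period: `[β/δ]⁻_f = im{∞, γ∞}_f / Ω⁻_f` for
# `γ = (α β; γ δ) ∈ Γ₀(N)`, hence a whole progression of cusps `(αk+β)/(γk+δ)` with `[·]⁻_f = 1/2`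
# — the modular-symbol input of the certificate (C2′) of crux `KatoKuriharaPortThreeShared`
# (stmt-BirchSwinnertonDyer-19560; cell `bsd-addord`, seat w2-c3 gen 4)

Route W2 `KimAtThreeKolyvagin`, §U child 19560 of crux 19076 `DeepUpperAtThree`.  kim3 gen 10's
certificate (C2′) (`Theorems/KimAtThreeKolyvaginPortSharedCert.lean`) asks, per row, for a cusp
`a₀/qⁿ` at which the rational minus symbol `[a₀/qⁿ]⁻_f = im(minusSymbol)/Ω⁻_f` of the newform `f` is
a `3`-adic unit.  This file shows that such cusps come for free from the DEFINITION of `Ω⁻_f`, for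
every rational newform and in every progression of denominators `δ + γℤ` attached to a suitable
`(α β; γ δ) ∈ Γ₀(N)` — no Ash–Stevens / Vatsal non-vanishing theorem is involved:

* `exists_cuspSymbol_eq_of_mem_periodLattice` — `Λ_f` (the closure of the periods `{∞, γ∞}_f`) IS
  the set of periods, because `γ ↦ {∞, γ∞}_f` is a homomorphism on `Γ₀(N)` (tree
  `cuspSymbol_mul_holds`, Manin 1972 Prop. 1.4).
* `exists_cuspSymbol_im_eq_half_minusPeriod` — for a rational newform `im Λ_f = ℤ·Ω⁻_f/2` with
  `Ω⁻_f > 0` (`IsNewform0.minusPeriod_pos_holds`, `minusPeriod_eq_zero_or`), so some `γ ∈ Γ₀(N)`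
  has `im{∞, γ∞}_f = Ω⁻_f/2`.
* `ratCast_ratMinusSymbol_gamma0_zero` — **`[β/δ]⁻_f = im{∞, γ∞}_f / Ω⁻_f`** for
  `γ = (α β; γ δ) ∈ Γ₀(N)`, `δ ≠ 0`: the Manin relation `{∞, γ·0}_f = {∞, γ∞}_f + {∞, 0}_f`
  (`modularSymbol_gamma0_smul_holds`, Manin 1972 Thm. 1.6) and `{∞, −r}_f = conj {∞, r}_f`
  (`modularSymbol_neg_eq_conj_holds`; `{∞, 0}_f` is real).
* `exists_progression_ratMinusSymbol_eq_half` — the assembled statement: integers `α β γ δ` with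
  `N ∣ γ`, `γ ≠ 0`, `αδ − βγ = 1` and `[(αk+β)/(γk+δ)]⁻_f = 1/2` for every `k ∈ ℤ` with
  `γk + δ ≠ 0` (right translation by `T^k` does not change the period: `{∞, T^k∞} = 0`; `T^k ∈ Γ₀(N)` is the tree's
  `Literature.NumberTheory.Automorphic.T_zpow_mem_Gamma0`).

THEOREMS ONLY (no definition, no named fact); closes nothing by itself; nothing is booked.
References: Ju. I. Manin, Izv. 36 (1972) Prop. 1.4, Thm. 1.6, Cor. 3.6 [Manin1972]; B. Mazur, J. Tate,
J. Teitelbaum, Invent. Math. 84 (1986) §I.8 [MazurTateTeitelbaum1986Invent]; J. Cremona,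
*Algorithms for modular elliptic curves* (1997) §2.1, §2.8 [CremonaAlgorithms1997]; kim3 memo
`HOME/kim3/KIM3-W2-PORT-g10.md` §3 (C2′).
-/

-- every file of this route lives in `Summit.BirchSwinnertonDyer.BirchSwinnertonDyer.Theorems.*` (summit =
-- problem name), so the duplicated-namespace linter is moot here (as in kim3's `KimAtThreeKolyvaginPortShared`).
set_option linter.dupNamespace false

noncomputable section

open scoped MatrixGroups ModularForm
open CongruenceSubgroup Matrix
open Literature.NumberTheory.EllipticCurves Literature.NumberTheory.EllipticCurves.ModularForms

namespace Summit.BirchSwinnertonDyer.BirchSwinnertonDyer.Theorems.KimAtThreePortSharedC2MinusSymbol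

variable {N : ℕ} [NeZero N]

/-! ### §1. The period lattice is the set of periods; a period with imaginary part `Ω⁻/2` -/

/-- **Every element of `Λ_f` is a period `{∞, γ∞}_f` of some `γ ∈ Γ₀(N)`**: `Λ_f` is the closure of
the range of `γ ↦ {∞, γ∞}_f`, which is a homomorphism (`cuspSymbol_mul_holds`), so its range is
already a subgroup. [cite: Manin1972, Prop. 1.4 / Thm. 1.6] -/
theorem exists_cuspSymbol_eq_of_mem_periodLattice (f : CuspForm (Gamma0 N) 2) {z : ℂ}
    (hz : z ∈ periodLattice f) : ∃ γ : Gamma0 N, cuspSymbol f γ = z := by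
  have hmul := cuspSymbol_mul_holds f
  have h1 : cuspSymbol f 1 = 0 := by
    have h := hmul 1 1
    rw [mul_one] at h
    -- `c = c + c`
    have : cuspSymbol f 1 + cuspSymbol f 1 = cuspSymbol f 1 + 0 := by rw [add_zero]; exact h.symm
    exact add_left_cancel this
  induction hz using AddSubgroup.closure_induction with
  | mem x hx =>
      obtain ⟨γ, rfl⟩ := hx
      exact ⟨γ, rfl⟩
  | zero => exact ⟨1, h1⟩
  | add x y _ _ hx hy =>
      obtain ⟨γ, rfl⟩ := hx
      obtain ⟨δ, rfl⟩ := hy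
      exact ⟨γ * δ, hmul γ δ⟩
  | neg x _ hx =>
      obtain ⟨γ, rfl⟩ := hx
      refine ⟨γ⁻¹, ?_⟩
      have h := hmul γ γ⁻¹
      rw [mul_inv_cancel, h1] at h
      -- `0 = c γ + c γ⁻¹`
      exact (neg_eq_of_add_eq_zero_right h.symm).symm

/-- **For a rational newform some `γ ∈ Γ₀(N)` has `im{∞, γ∞}_f = Ω⁻_f/2`, and `Ω⁻_f > 0`**:
`im Λ_f = ℤ·(Ω⁻_f/2)` (`minusPeriod_eq_zero_or`, with `Ω⁻_f > 0` by `IsNewform0.minusPeriod_pos_holds`)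
and `Λ_f` consists of periods. [cite: CremonaAlgorithms1997, §2.8] -/
theorem exists_cuspSymbol_im_eq_half_minusPeriod {f : CuspForm (Gamma0 N) 2} (hf : IsNewform0 f)
    (hQ : coeffField f = ⊥) :
    0 < minusPeriod f ∧ ∃ γ : Gamma0 N, (cuspSymbol f γ).im = minusPeriod f / 2 := by
  have hpos : 0 < minusPeriod f := IsNewform0.minusPeriod_pos_holds (f := f) hf hQ
  refine ⟨hpos, ?_⟩
  rcases minusPeriod_eq_zero_or (f := f) with h0 | ⟨-, him⟩
  · exact absurd h0 hpos.ne'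
  · have hmem : minusPeriod f / 2 ∈ imagPeriods f := by
      rw [him]; exact AddSubgroup.mem_zmultiples _
    rw [imagPeriods, AddSubgroup.mem_map] at hmem
    obtain ⟨z, hz, hzim⟩ := hmem
    obtain ⟨γ, hγ⟩ := exists_cuspSymbol_eq_of_mem_periodLattice f hz
    refine ⟨γ, ?_⟩
    rw [hγ, ← hzim]
    rfl

/-! ### §2. The minus symbol at `γ·0` is a period -/

/-- **`[β/δ]⁻_f = im{∞, γ∞}_f / Ω⁻_f` for `γ = (α β; γ δ) ∈ Γ₀(N)` with `δ ≠ 0`**, for a cusp form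
with real coefficients, at the level of `normalizedMinusSymbol = im(minusSymbol)/Ω⁻`: by the Manin
relation `{∞, γ·0}_f = {∞, γ∞}_f + {∞, 0}_f` (`modularSymbol_gamma0_smul_holds` at `r = 0`) and
`{∞, −r}_f = conj{∞, r}_f` (`modularSymbol_neg_eq_conj_holds`; in particular `{∞, 0}_f ∈ ℝ`),
`minusSymbol f (β/δ) = ({∞, β/δ} − conj{∞, β/δ})/2 = i·im{∞, γ∞}_f`.
[cite: Manin1972, Prop. 1.4  Thm. 1.6] [cite: MazurTateTeitelbaum1986Invent, §I.8] -/
theorem normalizedMinusSymbol_gamma0_zero (f : CuspForm (Gamma0 N) 2)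
    (hreal : ∀ n, (cuspCoeff f n).im = 0) (γ : Gamma0 N) (hδ : ((γ : SL(2, ℤ)) 1 1 : ℤ) ≠ 0) :
    normalizedMinusSymbol f ((((γ : SL(2, ℤ)) 0 1 : ℤ) : ℚ) / (((γ : SL(2, ℤ)) 1 1 : ℤ) : ℚ)) =
      (cuspSymbol f γ).im / minusPeriod f := by
  set r : ℚ := (((γ : SL(2, ℤ)) 0 1 : ℤ) : ℚ) / (((γ : SL(2, ℤ)) 1 1 : ℤ) : ℚ) with hr
  -- Manin relation at the cusp `0`
  have hr0 : ((γ : SL(2, ℤ)) 1 0 : ℚ) * 0 + ((γ : SL(2, ℤ)) 1 1 : ℚ) ≠ 0 := by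
    rw [mul_zero, zero_add]; exact_mod_cast hδ
  have hManin := modularSymbol_gamma0_smul_holds f γ 0 hr0
  rw [mul_zero, zero_add, mul_zero, zero_add] at hManin
  -- `hManin : modularSymbol f (γ01 / γ11) = cuspSymbol f γ + modularSymbol f 0`
  have hconj := modularSymbol_neg_eq_conj_holds f hreal
  have h0real : (modularSymbol f 0).im = 0 := by
    have h := hconj 0
    rw [neg_zero] at h
    -- `z = conj z`
    exact Complex.conj_eq_iff_im.mp h.symm
  have hms : minusSymbol f r = (modularSymbol f r - starRingEnd ℂ (modularSymbol f r)) / 2 := by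
    rw [minusSymbol, hconj r]
  have him : (minusSymbol f r).im = (cuspSymbol f γ).im := by
    rw [hms, Complex.div_ofNat_im, Complex.sub_im, Complex.conj_im, hr, hManin, Complex.add_im, h0real]
    ring
  rw [normalizedMinusSymbol, him]

/-- **`[β/δ]⁻_f = im{∞, γ∞}_f / Ω⁻_f` for a rational newform and `γ = (α β; γ δ) ∈ Γ₀(N)`,
`δ ≠ 0`** — the rational minus symbol (`ratCast_ratMinusSymbol`: `([r]⁻_f : ℝ) = im(minusSymbol)/Ω⁻_f`
for rational newforms, Manin–Drinfeld) at `γ·0 = β/δ` is the normalised imaginary part of the period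
of `γ`; the coefficients are real because they are rational (`coeffField f = ⊥`).
[cite: Manin1972, Prop. 1.4  Thm. 1.6] [cite: MazurTateTeitelbaum1986Invent, §I.8] -/
theorem ratCast_ratMinusSymbol_gamma0_zero {f : CuspForm (Gamma0 N) 2} (hf : IsNewform0 f)
    (hQ : coeffField f = ⊥) (hreal : ∀ n, (cuspCoeff f n).im = 0) (γ : Gamma0 N)
    (hδ : ((γ : SL(2, ℤ)) 1 1 : ℤ) ≠ 0) :
    (ratMinusSymbol f ((((γ : SL(2, ℤ)) 0 1 : ℤ) : ℚ) / (((γ : SL(2, ℤ)) 1 1 : ℤ) : ℚ)) : ℝ) =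
      (cuspSymbol f γ).im / minusPeriod f := by
  rw [ratCast_ratMinusSymbol f hf hQ, normalizedMinusSymbol_gamma0_zero f hreal γ hδ]

/-! ### §3. Translating by `T^k`: a progression of cusps with `[·]⁻_f = 1/2` -/

/-- The period of a right translate by `T^k` is unchanged: `{∞, (γT^k)∞}_f = {∞, γ∞}_f`
(`cuspSymbol_mul_holds` and `{∞, T^k∞}_f = {∞, ∞}_f = 0`). [cite: Manin1972, Prop. 1.4] -/
theorem cuspSymbol_mul_T_zpow (f : CuspForm (Gamma0 N) 2) (γ : Gamma0 N) (k : ℤ) :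
    cuspSymbol f (γ * ⟨ModularGroup.T ^ k, Literature.NumberTheory.Automorphic.T_zpow_mem_Gamma0 k⟩) = cuspSymbol f γ := by
  rw [cuspSymbol_mul_holds f, add_eq_left]
  -- lower-left entry of `T^k` is `0`
  have h10 : ((⟨ModularGroup.T ^ k, Literature.NumberTheory.Automorphic.T_zpow_mem_Gamma0 k⟩ : Gamma0 N) : SL(2, ℤ)) 1 0 = 0 := by
    change (ModularGroup.T ^ k : SL(2, ℤ)) 1 0 = 0
    rw [ModularGroup.coe_T_zpow]; simp
  rw [cuspSymbol, if_pos h10]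

omit [NeZero N] in
/-- Entries of `γ T^k` for `γ = (α β; γ δ)`: `(γT^k)₀₁ = αk + β`, `(γT^k)₁₀ = γ`, `(γT^k)₁₁ = γk + δ`.
[folklore] -/
theorem coe_mul_T_zpow_apply (γ : Gamma0 N) (k : ℤ) :
    ((γ * ⟨ModularGroup.T ^ k, Literature.NumberTheory.Automorphic.T_zpow_mem_Gamma0 k⟩ : Gamma0 N) : SL(2, ℤ)) 0 1 =
        (γ : SL(2, ℤ)) 0 0 * k + (γ : SL(2, ℤ)) 0 1 ∧
      ((γ * ⟨ModularGroup.T ^ k, Literature.NumberTheory.Automorphic.T_zpow_mem_Gamma0 k⟩ : Gamma0 N) : SL(2, ℤ)) 1 0 =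
        (γ : SL(2, ℤ)) 1 0 ∧
      ((γ * ⟨ModularGroup.T ^ k, Literature.NumberTheory.Automorphic.T_zpow_mem_Gamma0 k⟩ : Gamma0 N) : SL(2, ℤ)) 1 1 =
        (γ : SL(2, ℤ)) 1 0 * k + (γ : SL(2, ℤ)) 1 1 := by
  have hmul : ((γ * ⟨ModularGroup.T ^ k, Literature.NumberTheory.Automorphic.T_zpow_mem_Gamma0 k⟩ : Gamma0 N) : SL(2, ℤ)) =
      (γ : SL(2, ℤ)) * ModularGroup.T ^ k := rfl
  have hT : ((ModularGroup.T ^ k : SL(2, ℤ)) : Matrix (Fin 2) (Fin 2) ℤ) = !![1, k; 0, 1] :=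
    ModularGroup.coe_T_zpow k
  refine ⟨?_, ?_, ?_⟩ <;>
  · rw [hmul, Matrix.SpecialLinearGroup.coe_mul, hT]
    simp [Matrix.mul_apply, Fin.sum_univ_two]

/-- **A progression of cusps with unit minus symbol, for every rational newform.**  For a
normalised newform `f ∈ S₂(Γ₀(N))` with rational coefficients there are integers `α β γ δ` with
`N ∣ γ`, `γ ≠ 0`, `αδ − βγ = 1` (so `gcd(γ, δ) = 1`), such that for EVERY `k ∈ ℤ` with
`γk + δ ≠ 0` the rational minus symbol at the cusp `(αk + β)/(γk + δ)` equals `1/2`: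
`[(αk+β)/(γk+δ)]⁻_f = im{∞, (α β; γ δ)∞}_f / Ω⁻_f = (Ω⁻_f/2)/Ω⁻_f`.  (Negating all four integers gives
the same cusps, so the sign of `δ` is at the consumer's disposal.)
[cite: Manin1972, Prop. 1.4  Thm. 1.6] [cite: MazurTateTeitelbaum1986Invent, §I.8] [cite: CremonaAlgorithms1997, §2.8] -/
theorem exists_progression_ratMinusSymbol_eq_half {f : CuspForm (Gamma0 N) 2} (hf : IsNewform0 f)
    (hQ : coeffField f = ⊥) (hreal : ∀ n, (cuspCoeff f n).im = 0) :
    ∃ α β γ δ : ℤ, (N : ℤ) ∣ γ ∧ γ ≠ 0 ∧ α * δ - β * γ = 1 ∧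
      ∀ k : ℤ, γ * k + δ ≠ 0 →
        ratMinusSymbol f (((α * k + β : ℤ) : ℚ) / ((γ * k + δ : ℤ) : ℚ)) = 1 / 2 := by
  obtain ⟨hpos, g, hg⟩ := exists_cuspSymbol_im_eq_half_minusPeriod hf hQ
  refine ⟨(g : SL(2, ℤ)) 0 0, (g : SL(2, ℤ)) 0 1, (g : SL(2, ℤ)) 1 0, (g : SL(2, ℤ)) 1 1, ?_, ?_, ?_,
    fun k hk => ?_⟩
  · -- `N ∣ γ`: membership in `Γ₀(N)`
    exact (ZMod.intCast_zmod_eq_zero_iff_dvd _ N).mp (Gamma0_mem.mp g.2)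
  · -- `γ ≠ 0`: otherwise the period `{∞, g∞}` would be `0`
    intro h0
    have hcs : cuspSymbol f g = 0 := by rw [cuspSymbol, if_pos h0]
    rw [hcs, Complex.zero_im] at hg
    linarith
  · -- determinant one
    have hdet := Matrix.SpecialLinearGroup.det_coe (g : SL(2, ℤ))
    rw [Matrix.det_fin_two] at hdet
    linear_combination hdet
  · set g' : Gamma0 N := g * ⟨ModularGroup.T ^ k, Literature.NumberTheory.Automorphic.T_zpow_mem_Gamma0 k⟩ with hg'
    obtain ⟨h01, -, h11⟩ := coe_mul_T_zpow_apply g k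
    have hδ' : ((g' : SL(2, ℤ)) 1 1 : ℤ) ≠ 0 := by rw [hg', h11]; exact hk
    have key := ratCast_ratMinusSymbol_gamma0_zero hf hQ hreal g' hδ'
    rw [hg', h01, h11, cuspSymbol_mul_T_zpow, hg, div_div_cancel_left' hpos.ne'] at key
    -- `key : (ratMinusSymbol f (...) : ℝ) = 2⁻¹`
    have key' : (ratMinusSymbol f ((((g : SL(2, ℤ)) 0 0 * k + (g : SL(2, ℤ)) 0 1 : ℤ) : ℚ) /
        (((g : SL(2, ℤ)) 1 0 * k + (g : SL(2, ℤ)) 1 1 : ℤ) : ℚ)) : ℝ) = ((1 / 2 : ℚ) : ℝ) := by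
      rw [key]; push_cast; ring
    exact_mod_cast key'

end Summit.BirchSwinnertonDyer.BirchSwinnertonDyer.Theorems.KimAtThreePortSharedC2MinusSymbol

end
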